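import Literature.MathematicalPhysics.QuantumLattice.SpectralProjectionFourierProofs
import Literature.MathematicalPhysics.QuantumLattice.HastingsGeneratorProofs
import Literature.MathematicalPhysics.QuantumLattice.LinearMatrixODEProofs
import Literature.MathematicalPhysics.QuantumLattice.SpectralFlowWeightProofs
import Literature.MathematicalPhysics.QuantumLattice.StabilityReductionProofs
import HarnessLib

/-!
# The spectral flow along a gapped affine path (Hastings' quasi-adiabatic continuation, packaged)

Glue layer of the formalisation of the Michalakis–Zwolak stability theorem (hubbard.S19,
`Literature.MathematicalPhysics.QuantumLattice.michalakis_zwolak`), assembling accepted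
ingredients of the spectral-flow line into the single statement consumed by
`michalakis_zwolak_of_flow_locality_core`: for the affine Hermitian path `H_t = H₀ + tX` which
has, for every `t ∈ [0, T]`, exactly `m` eigenvalues in a low window separated by a gap `g > 0`
from the rest (`HasClusterGap m ω_t g`), there is a unitary `U` with
`U⋆ P(T) U = P(0)`, where `P(t)` is the spectral projection of `H_t` onto its `m` lowest
eigenvalues (`exists_spectral_flow_of_clusterGap`). Michalakis–Zwolak, arXiv:1109.1588 §5.2:
"the unitary `U(s)` satisfies `U(s) P₀ U†(s) = P₀(s)`"; Bachmann–Michalakis–Nachtergaele–Sims,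
arXiv:1102.0842 §2 (Prop. 2.4 and eq. (2.15)).

Ingredients (all in the tree): Hastings' equation for a fixed-threshold cluster projection on a
neighbourhood (`hasDerivAt_clusterProj`, `SpectralProjectionFourierProofs`), the weight
(`exists_spectralFlowWeight`), continuity/boundedness/hermiticity of the generator
`D(t) = ∫ W(τ) τ_τ^{H_t}(X) dτ` (`HastingsGeneratorProofs`), the unitary flow with intertwining
(`exists_unitary_flow`, `LinearMatrixODEProofs`), Weyl-type eigenvalue perturbation
(`exists_abs_eigenvalues_sub_le_of_eigenvalue`, `sepCount_of_norm_sub_le`,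
`exists_hasClusterGap_of_norm_sub_le`). New here: the *count-defined* cluster index set
`S_t = {k | #{l | λ_l(t) ≤ λ_k(t)} ≤ m}` (canonical, threshold-free), its identification with
`{λ ≤ E₀ + ω}` under a cluster gap and with the fixed-threshold sets locally in `t`, and the
assembly. No definitions, no named facts (theorems only).
-/

noncomputable section

open Matrix Finset Module MeasureTheory Complex Filter
open scoped InnerProductSpace ComplexOrder Matrix.Norms.L2Operator Topology

namespace Literature.MathematicalPhysics.QuantumLattice

/-! ### Eigen-data of equal matrices; eigenvalue bounds -/

section EigenData

variable {n : Type*} [Fintype n] [DecidableEq n]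

/-- Eigenvalues of (propositionally) equal Hermitian matrices agree, whatever the proofs.
[folklore] -/
theorem eigenvalues_eq_of_eq {A B : Matrix n n ℂ} (e : A = B) (hA : A.IsHermitian) (hB : B.IsHermitian) :
    hA.eigenvalues = hB.eigenvalues := by
  subst e; rfl

/-- Eigenvector bases of (propositionally) equal Hermitian matrices agree, whatever the proofs.
[folklore] -/
theorem eigenvectorBasis_eq_of_eq {A B : Matrix n n ℂ} (e : A = B) (hA : A.IsHermitian)
    (hB : B.IsHermitian) : hA.eigenvectorBasis = hB.eigenvectorBasis := by
  subst e; rfl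

/-- Every eigenvalue is bounded by the operator norm: `|λₖ| ≤ ‖A‖`. [folklore] -/
theorem abs_eigenvalues_le_norm {A : Matrix n n ℂ} (hA : A.IsHermitian) (k : n) :
    |hA.eigenvalues k| ≤ ‖A‖ := by
  have h := abs_re_inner_toEuclideanLin_le' A (hA.eigenvectorBasis k)
  rw [← eigenvalues_eq_re_inner hA k, hA.eigenvectorBasis.orthonormal.1 k, one_pow, mul_one] at h
  exact h

/-- **Weyl, spectral-distance form**: if `‖A − B‖ ≤ τ` then every eigenvalue of `B` is within
`τ` of some eigenvalue of `A`. [folklore] -/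
theorem exists_abs_eigenvalues_sub_le_of_norm_sub_le {A B : Matrix n n ℂ} (hA : A.IsHermitian)
    (hB : B.IsHermitian) {τ : ℝ} (h : ‖A - B‖ ≤ τ) (j : n) :
    ∃ k, |hA.eigenvalues k - hB.eigenvalues j| ≤ τ := by
  haveI : Nonempty n := ⟨j⟩
  obtain ⟨k, hk⟩ := Literature.LinearAlgebra.Matrix.exists_abs_eigenvalues_sub_le_of_eigenvalue hA hB j
  refine ⟨k, hk.trans ?_⟩
  rw [← LinearMap.sub_apply, ← map_sub]
  calc ‖toEuclideanLin (A - B) (hB.eigenvectorBasis j)‖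
      ≤ ‖toEuclideanCLM (n := n) (𝕜 := ℂ) (A - B)‖ * ‖(hB.eigenvectorBasis j : EuclideanSpace ℂ n)‖ :=
        (toEuclideanCLM (n := n) (𝕜 := ℂ) (A - B)).le_opNorm _
    _ ≤ τ * 1 := by
        rw [← Matrix.cstar_norm_def, hB.eigenvectorBasis.orthonormal.1 j]
        exact mul_le_mul_of_nonneg_right h zero_le_one
    _ = τ := mul_one τ

end EigenData

/-! ### The count-defined cluster index set -/

section ClusterSet

variable {n : Type*} [Fintype n] [DecidableEq n]

omit [DecidableEq n] in
/-- Threshold sets of a real function on a finite type with equal cardinality are equal (they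
are nested). [folklore] -/
theorem filter_le_eq_of_card_eq (f : n → ℝ) {θ₁ θ₂ : ℝ}
    (h : (univ.filter fun k => f k ≤ θ₁).card = (univ.filter fun k => f k ≤ θ₂).card) :
    (univ.filter fun k => f k ≤ θ₁) = (univ.filter fun k => f k ≤ θ₂) := by
  rcases le_total θ₁ θ₂ with hle | hle
  · exact eq_of_subset_of_card_le (fun k hk => by
      simp only [mem_filter, mem_univ, true_and] at hk ⊢; exact hk.trans hle) h.ge
  · exact (eq_of_subset_of_card_le (fun k hk => by
      simp only [mem_filter, mem_univ, true_and] at hk ⊢; exact hk.trans hle) h.le).symm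

/-- **The count-defined cluster set is the low window under a cluster gap.** If the Hermitian
`A` has exactly `m` eigenvalues `≤ E₀ + ω` and all others `≥ E₀ + ω + g`, `g > 0`
(`HasClusterGap m ω g`), then `{k | #{l | λ_l ≤ λ_k} ≤ m} = {k | λ_k ≤ E₀ + ω}`.
[folklore] -/
theorem clusterSet_eq_filter {A : Matrix n n ℂ} (hA : A.IsHermitian) {m : ℕ} {ω g : ℝ}
    (h : A.HasClusterGap m ω g) :
    (univ.filter fun k => (univ.filter fun l => hA.eigenvalues l ≤ hA.eigenvalues k).card ≤ m) =
      (univ.filter fun k => hA.eigenvalues k ≤ (⨅ j, hA.eigenvalues j) + ω) := by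
  obtain ⟨hA', -, hg, hcount, hsep⟩ := h
  ext k
  simp only [mem_filter, mem_univ, true_and]
  constructor
  · intro hk
    by_contra hnot
    -- `k` is above the window: the set `{λ_l ≤ λ_k}` contains the cluster and `k`
    have hkbig : (⨅ j, hA.eigenvalues j) + ω + g ≤ hA.eigenvalues k := by
      rcases hsep k with h1 | h1
      · exact absurd h1 hnot
      · exact h1
    have hsub : (univ.filter fun l => hA.eigenvalues l ≤ (⨅ j, hA.eigenvalues j) + ω) ⊆
        (univ.filter fun l => hA.eigenvalues l ≤ hA.eigenvalues k) := fun l hl => by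
      simp only [mem_filter, mem_univ, true_and] at hl ⊢
      linarith
    have hkmem : k ∈ (univ.filter fun l => hA.eigenvalues l ≤ hA.eigenvalues k) := by simp
    have hknot : k ∉ (univ.filter fun l => hA.eigenvalues l ≤ (⨅ j, hA.eigenvalues j) + ω) := by
      simpa using hnot
    have hcard := card_lt_card (Finset.ssubset_iff_of_subset hsub |>.mpr ⟨k, hkmem, hknot⟩)
    rw [hcount] at hcard
    exact absurd hk (not_le.mpr hcard)
  · intro hk
    calc (univ.filter fun l => hA.eigenvalues l ≤ hA.eigenvalues k).card
        ≤ (univ.filter fun l => hA.eigenvalues l ≤ (⨅ j, hA.eigenvalues j) + ω).card :=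
          card_le_card fun l hl => by
            simp only [mem_filter, mem_univ, true_and] at hl ⊢
            exact hl.trans hk
      _ = m := hcount

/-- Under a cluster gap the count-defined cluster set has `m` elements. [folklore] -/
theorem card_clusterSet {A : Matrix n n ℂ} (hA : A.IsHermitian) {m : ℕ} {ω g : ℝ}
    (h : A.HasClusterGap m ω g) :
    (univ.filter fun k => (univ.filter fun l => hA.eigenvalues l ≤ hA.eigenvalues k).card ≤ m).card = m := by
  rw [clusterSet_eq_filter hA h]
  exact h.2.2.2.1

/-- **Separation of the count-defined cluster set**: under `HasClusterGap m ω g`, eigenvalues in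
the cluster set and outside it differ by at least `g`. [folklore] -/
theorem clusterSet_separated {A : Matrix n n ℂ} (hA : A.IsHermitian) {m : ℕ} {ω g : ℝ}
    (h : A.HasClusterGap m ω g) :
    ∀ k ∈ (univ.filter fun k => (univ.filter fun l => hA.eigenvalues l ≤ hA.eigenvalues k).card ≤ m),
      ∀ l ∉ (univ.filter fun k => (univ.filter fun l => hA.eigenvalues l ≤ hA.eigenvalues k).card ≤ m),
        g ≤ |hA.eigenvalues k - hA.eigenvalues l| := by
  rw [clusterSet_eq_filter hA h]
  obtain ⟨hA', -, hg, hcount, hsep⟩ := h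
  intro k hk l hl
  simp only [mem_filter, mem_univ, true_and, not_le] at hk hl
  rcases hsep l with h1 | h1
  · exact absurd h1 (not_le.mpr hl)
  · rw [abs_sub_comm, abs_of_nonneg (by linarith)]
    linarith

end ClusterSet

/-! ### The cluster set along the affine path: local fixed threshold and Hastings' equation -/

section Path

variable {n : Type*} [Fintype n] [DecidableEq n]

/-- Norm of the difference of two points of the affine path: `‖H_{t₀} − H_t‖ = |t₀ − t| ‖X‖`.
[folklore] -/
theorem norm_affinePath_sub (H₀ X : Matrix n n ℂ) (t₀ t : ℝ) :
    ‖(H₀ + t₀ • X) - (H₀ + t • X)‖ = |t₀ - t| * ‖X‖ := by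
  rw [add_sub_add_left_eq_sub, ← sub_smul, norm_smul, Real.norm_eq_abs]

/-- **Local fixed-threshold description of the cluster set.** If `H_{t₀} = H₀ + t₀X` has the
cluster gap `(m, ω, g)` and `|t₀ − t| ‖X‖ ≤ g/8`, then the count-defined cluster set of `H_t` is
the threshold set `{λ(t) ≤ E₀(t₀) + ω + g/4}`, and every eigenvalue of `H_t` avoids the window
`(E₀(t₀) + ω + g/4, E₀(t₀) + ω + 3g/4)` (Weyl's bound: eigenvalues move by at most `g/8`).
[folklore] -/
theorem clusterSet_eq_filter_le_near [Nonempty n] {H₀ X : Matrix n n ℂ} (hH₀ : H₀.IsHermitian)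
    (hX : X.IsHermitian) {m : ℕ} {ω g : ℝ} {t₀ t : ℝ}
    (h : (H₀ + t₀ • X).HasClusterGap m ω g) (ht : |t₀ - t| * ‖X‖ ≤ g / 8) :
    ((univ.filter fun k => (univ.filter fun l =>
        (isHermitian_affinePath hH₀ hX t).eigenvalues l ≤
          (isHermitian_affinePath hH₀ hX t).eigenvalues k).card ≤ m) =
      (univ.filter fun k => (isHermitian_affinePath hH₀ hX t).eigenvalues k ≤
        (⨅ j, (isHermitian_affinePath hH₀ hX t₀).eigenvalues j) + ω + g / 4)) ∧
    ∀ k, (isHermitian_affinePath hH₀ hX t).eigenvalues k ≤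
        (⨅ j, (isHermitian_affinePath hH₀ hX t₀).eigenvalues j) + ω + g / 4 ∨
      (⨅ j, (isHermitian_affinePath hH₀ hX t₀).eigenvalues j) + ω + 3 * g / 4 ≤
        (isHermitian_affinePath hH₀ hX t).eigenvalues k := by
  set hA := isHermitian_affinePath hH₀ hX t₀ with hhA
  set hB := isHermitian_affinePath hH₀ hX t with hhB
  set τ : ℝ := |t₀ - t| * ‖X‖ with hτdef
  have hg : 0 < g := h.2.2.1
  have hm : 0 < m := h.pos
  have hnorm : ‖(H₀ + t₀ • X) - (H₀ + t • X)‖ ≤ τ := (norm_affinePath_sub H₀ X t₀ t).le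
  have h2τ : 2 * τ < g := by linarith
  -- the cluster gap propagates to `H_t`
  obtain ⟨ω', -, hgap'⟩ := exists_hasClusterGap_of_norm_sub_le hB hm h hnorm h2τ
  -- Weyl counting at the threshold `E₀(t₀) + ω + τ`
  have hE : (⨅ j, hA.eigenvalues j) = ⨅ j, h.isHermitian.eigenvalues j := rfl
  obtain ⟨hcountB, hsepB⟩ := sepCount_of_norm_sub_le (𝕜 := ℂ) hA hB (t := τ)
    (e := (⨅ j, hA.eigenvalues j) + ω) (g := g) (m := m) (by rwa [← Matrix.cstar_norm_def])
    h.2.2.2.1 h.2.2.2.2 h2τ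
  -- the threshold sets `≤ E₀+ω+τ` and `≤ E₀+ω+g/4` coincide
  have hwin : ∀ k, hB.eigenvalues k ≤ (⨅ j, hA.eigenvalues j) + ω + g / 4 ∨
      (⨅ j, hA.eigenvalues j) + ω + 3 * g / 4 ≤ hB.eigenvalues k := by
    intro k
    rcases hsepB k with h1 | h1
    · left; linarith
    · right; linarith
  have hcount4 : (univ.filter fun k => hB.eigenvalues k ≤ (⨅ j, hA.eigenvalues j) + ω + g / 4).card = m := by
    have hset : (univ.filter fun k => hB.eigenvalues k ≤ (⨅ j, hA.eigenvalues j) + ω + g / 4) =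
        (univ.filter fun k => hB.eigenvalues k ≤ (⨅ j, hA.eigenvalues j) + ω + τ) := by
      ext k
      simp only [mem_filter, mem_univ, true_and]
      constructor
      · intro hk
        rcases hsepB k with h1 | h1
        · exact h1
        · linarith
      · intro hk; linarith
    rw [hset]; exact hcountB
  refine ⟨?_, hwin⟩
  refine filter_le_eq_of_card_eq_aux hB hgap' hcount4
where
  /-- auxiliary: the count-defined set equals any threshold set of cardinality `m` under a gap -/
  filter_le_eq_of_card_eq_aux {B : Matrix n n ℂ} (hB : B.IsHermitian) {m : ℕ} {ω' g' θ : ℝ}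
      (hgap' : B.HasClusterGap m ω' g')
      (hθ : (univ.filter fun k => hB.eigenvalues k ≤ θ).card = m) :
      (univ.filter fun k => (univ.filter fun l => hB.eigenvalues l ≤ hB.eigenvalues k).card ≤ m) =
        (univ.filter fun k => hB.eigenvalues k ≤ θ) := by
    rw [clusterSet_eq_filter hB hgap']
    exact filter_le_eq_of_card_eq hB.eigenvalues ((hgap'.2.2.2.1).trans hθ.symm)

/-- **Hastings' equation for the count-defined cluster projection along the path.** If
`H_{t₀}` has the cluster gap `(m, ω, g)`, then the projection
`P(t) = projMatrix (span {uₖ(t) | k ∈ S_t})` onto the count-defined cluster set is differentiable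
at `t₀` with `P'(t₀) = i[D(t₀), P(t₀)]`, `D(t₀) = ∫ W(τ) τ_τ^{H_{t₀}}(X) dτ`, for every integrable
weight `W` with `∫ e^{iτΔ} W = i/Δ` for `|Δ| ≥ g/2` (`hasDerivAt_clusterProj` with the local fixed
threshold `E₀(t₀) + ω + g/4`). [folklore] -/
theorem hasDerivAt_clusterProj_count [Nonempty n] {H₀ X : Matrix n n ℂ} (hH₀ : H₀.IsHermitian)
    (hX : X.IsHermitian) {m : ℕ} {ω g : ℝ} {t₀ : ℝ} (h : (H₀ + t₀ • X).HasClusterGap m ω g)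
    {W : ℝ → ℂ} (hWi : Integrable W)
    (hW : ∀ Δ : ℝ, g / 2 ≤ |Δ| → ∫ t : ℝ, cexp (t * Δ * I) * W t = I / Δ) :
    HasDerivAt (fun t : ℝ => projMatrix (Submodule.span ℂ (Set.range fun i :
        (univ.filter fun k => (univ.filter fun l =>
          (isHermitian_affinePath hH₀ hX t).eigenvalues l ≤
            (isHermitian_affinePath hH₀ hX t).eigenvalues k).card ≤ m) =>
          (isHermitian_affinePath hH₀ hX t).eigenvectorBasis i)))
      (I • ((∫ τ : ℝ, W τ • heisenbergEvolution (H₀ + t₀ • X) τ X) *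
          projMatrix (Submodule.span ℂ (Set.range fun i :
            (univ.filter fun k => (univ.filter fun l =>
              (isHermitian_affinePath hH₀ hX t₀).eigenvalues l ≤
                (isHermitian_affinePath hH₀ hX t₀).eigenvalues k).card ≤ m) =>
              (isHermitian_affinePath hH₀ hX t₀).eigenvectorBasis i)) -
        projMatrix (Submodule.span ℂ (Set.range fun i :
            (univ.filter fun k => (univ.filter fun l =>
              (isHermitian_affinePath hH₀ hX t₀).eigenvalues l ≤
                (isHermitian_affinePath hH₀ hX t₀).eigenvalues k).card ≤ m) =>
              (isHermitian_affinePath hH₀ hX t₀).eigenvectorBasis i)) *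
          ∫ τ : ℝ, W τ • heisenbergEvolution (H₀ + t₀ • X) τ X)) t₀ := by
  set hHt := isHermitian_affinePath hH₀ hX with hhHt
  have hg : 0 < g := h.2.2.1
  set E₀ : ℝ := ⨅ j, (hHt t₀).eigenvalues j with hE₀
  set a' : ℝ := E₀ + ω + g / 4 with ha'
  set b' : ℝ := E₀ + ω + 3 * g / 4 with hb'
  set R : ℝ := ‖H₀‖ + (|t₀| + 1) * ‖X‖ + |a'| + 1 with hR
  set ρ : ℝ := min 1 (g / (8 * (‖X‖ + 1))) with hρ
  have hρpos : 0 < ρ := lt_min one_pos (by positivity)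
  set J : Set ℝ := Metric.ball t₀ ρ with hJ
  have hJmem : J ∈ 𝓝 t₀ := Metric.ball_mem_nhds t₀ hρpos
  -- on `J` the perturbation is small
  have hsmall : ∀ t ∈ J, |t₀ - t| * ‖X‖ ≤ g / 8 := by
    intro t htJ
    have h1 : |t₀ - t| < ρ := by rw [abs_sub_comm]; exact htJ
    have hX0 : 0 ≤ ‖X‖ := norm_nonneg X
    have h2 : |t₀ - t| * ‖X‖ ≤ ρ * ‖X‖ := mul_le_mul_of_nonneg_right h1.le hX0
    have h3 : ρ * ‖X‖ ≤ g / (8 * (‖X‖ + 1)) * ‖X‖ :=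
      mul_le_mul_of_nonneg_right (min_le_right _ _) hX0
    have h4 : g / (8 * (‖X‖ + 1)) * ‖X‖ ≤ g / 8 := by
      rw [div_mul_eq_mul_div, div_le_div_iff₀ (by positivity) (by norm_num)]
      nlinarith
    linarith
  -- the spectral window on `J`
  have hspec : ∀ t ∈ J, ∀ k, ((hHt t).eigenvalues k ≤ a' ∨ b' ≤ (hHt t).eigenvalues k) ∧
      -R ≤ (hHt t).eigenvalues k := by
    intro t htJ k
    refine ⟨(clusterSet_eq_filter_le_near hH₀ hX h (hsmall t htJ)).2 k, ?_⟩
    have hbd := abs_eigenvalues_le_norm (hHt t) k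
    have hnt : ‖H₀ + t • X‖ ≤ ‖H₀‖ + (|t₀| + 1) * ‖X‖ := by
      have h1 : |t| ≤ |t₀| + 1 := by
        have hlt : |t - t₀| < ρ := by
          have := htJ; rwa [hJ, Metric.mem_ball, Real.dist_eq] at this
        have : |t - t₀| < 1 := lt_of_lt_of_le hlt (min_le_left _ _)
        have := abs_sub_abs_le_abs_sub t t₀
        linarith
      calc ‖H₀ + t • X‖ ≤ ‖H₀‖ + ‖t • X‖ := norm_add_le _ _
        _ = ‖H₀‖ + |t| * ‖X‖ := by rw [norm_smul, Real.norm_eq_abs]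
        _ ≤ ‖H₀‖ + (|t₀| + 1) * ‖X‖ := by gcongr
    have := (abs_le.mp (hbd.trans hnt)).1
    have ha0 : 0 ≤ |a'| := abs_nonneg _
    rw [hR]; linarith
  have hRa : -R < a' := by
    have := neg_abs_le a'
    have : 0 ≤ ‖H₀‖ + (|t₀| + 1) * ‖X‖ := by positivity
    rw [hR]; linarith
  have hab : g / 2 ≤ b' - a' := by rw [ha', hb']; linarith
  -- Hastings' equation for the fixed threshold `a'`
  have hfix := hasDerivAt_clusterProj hH₀ hX (half_pos hg) hab hRa hJmem hspec hWi hW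
  -- the count-defined projection agrees with the fixed-threshold one on `J`
  have heq : ∀ t ∈ J, projMatrix (Submodule.span ℂ (Set.range fun i :
      (univ.filter fun k => (univ.filter fun l =>
        (hHt t).eigenvalues l ≤ (hHt t).eigenvalues k).card ≤ m) => (hHt t).eigenvectorBasis i)) =
      projMatrix (Submodule.span ℂ (Set.range fun i :
        ({k | (hHt t).eigenvalues k ≤ a'} : Finset n) => (hHt t).eigenvectorBasis i)) := by
    intro t htJ
    rw [(clusterSet_eq_filter_le_near hH₀ hX h (hsmall t htJ)).1]
  have hev : (fun t : ℝ => projMatrix (Submodule.span ℂ (Set.range fun i :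
      (univ.filter fun k => (univ.filter fun l =>
        (hHt t).eigenvalues l ≤ (hHt t).eigenvalues k).card ≤ m) => (hHt t).eigenvectorBasis i))) =ᶠ[𝓝 t₀]
      (fun t : ℝ => projMatrix (Submodule.span ℂ (Set.range fun i :
        ({k | (hHt t).eigenvalues k ≤ a'} : Finset n) => (hHt t).eigenvectorBasis i))) :=
    Filter.mem_of_superset hJmem fun t htJ => heq t htJ
  have h0 := heq t₀ (Metric.mem_ball_self hρpos)
  have key := hfix.congr_of_eventuallyEq hev
  rw [← h0] at key
  exact key

end Path

/-! ### The spectral flow -/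

section Flow

variable {n : Type*} [Fintype n] [DecidableEq n]

/-- **The spectral flow along a gapped affine path.** Let `H₀`, `X` be Hermitian and suppose
that for every `t ∈ [0, T]` the matrix `H_t = H₀ + tX` has exactly `m` eigenvalues in a low
window separated by a gap `g > 0` from the rest of its spectrum (`HasClusterGap m ω_t g`). Then
there is a unitary `U` with `U⋆ P(T) U = P(0)`, where `P(t)` is the orthogonal projection onto
the span of the eigenvectors of `H_t` in the count-defined cluster set
`S_t = {k | #{l | λ_l(t) ≤ λ_k(t)} ≤ m}` (its `m` lowest eigenvalues). This is Hastings'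
quasi-adiabatic continuation: `U = U(T)` for the flow `∂_t U = i D(t) U`, `U(0) = 1`, of the
generator `D(t) = ∫ W(τ) τ_τ^{H_t}(X) dτ` (`exists_spectralFlowWeight`, `exists_unitary_flow`),
whose intertwining property rests on Hastings' equation `P' = i[D, P]`
(`hasDerivAt_clusterProj_count`). Michalakis–Zwolak, arXiv:1109.1588 §5.2 ("the unitary `U(s)`
satisfies `U(s) P₀ U†(s) = P₀(s)`"); Bachmann–Michalakis–Nachtergaele–Sims, arXiv:1102.0842
§2 Prop. 2.4. [cite: MichalakisZwolakCMP2013, §5.2 (arXiv:1109.1588 pp. 10–12)] -/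
theorem exists_spectral_flow_of_clusterGap {H₀ X : Matrix n n ℂ} (hH₀ : H₀.IsHermitian)
    (hX : X.IsHermitian) {m : ℕ} {g T : ℝ} (hg : 0 < g) (hT : 0 ≤ T)
    (hgap : ∀ t ∈ Set.Icc (0 : ℝ) T, ∃ ω : ℝ, (H₀ + t • X).HasClusterGap m ω g) :
    ∃ U : Matrix n n ℂ, U ∈ unitary (Matrix n n ℂ) ∧
      star U * projMatrix (Submodule.span ℂ (Set.range fun i :
          (univ.filter fun k => (univ.filter fun l =>
            (isHermitian_affinePath hH₀ hX T).eigenvalues l ≤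
              (isHermitian_affinePath hH₀ hX T).eigenvalues k).card ≤ m) =>
            (isHermitian_affinePath hH₀ hX T).eigenvectorBasis i)) * U =
        projMatrix (Submodule.span ℂ (Set.range fun i :
          (univ.filter fun k => (univ.filter fun l =>
            (isHermitian_affinePath hH₀ hX 0).eigenvalues l ≤
              (isHermitian_affinePath hH₀ hX 0).eigenvalues k).card ≤ m) =>
            (isHermitian_affinePath hH₀ hX 0).eigenvectorBasis i)) := by
  rcases isEmpty_or_nonempty n with hn | hn
  · exact ⟨1, one_mem _, Subsingleton.elim _ _⟩
  set hHt := isHermitian_affinePath hH₀ hX with hhHt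
  -- the weight and the generator
  obtain ⟨W, -, -, -, hWi, hW, hWr⟩ := exists_spectralFlowWeight (half_pos hg)
  set D : ℝ → Matrix n n ℂ := fun t => ∫ τ : ℝ, W τ • heisenbergEvolution (H₀ + t • X) τ X with hDdef
  have hDc : Continuous D := continuous_integral_smul_heisenbergEvolution_affine hH₀ hX hWi X
  have hDM : ∀ t, ‖D t‖ ≤ (∫ τ : ℝ, ‖W τ‖) * ‖X‖ := fun t =>
    norm_integral_smul_heisenbergEvolution_affine_le hH₀ hX W X t
  have hDh : ∀ t, (D t).IsHermitian := fun t =>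
    isHermitian_integral_smul_heisenbergEvolution (hHt t) hX hWi hWr
  -- the count-defined cluster projection
  set P : ℝ → Matrix n n ℂ := fun t => projMatrix (Submodule.span ℂ (Set.range fun i :
      (univ.filter fun k => (univ.filter fun l =>
        (hHt t).eigenvalues l ≤ (hHt t).eigenvalues k).card ≤ m) => (hHt t).eigenvectorBasis i))
    with hPdef
  have hP : ∀ s ∈ Set.Icc (0 : ℝ) T,
      HasDerivWithinAt P ((Complex.I : ℂ) • (D s * P s - P s * D s)) (Set.Icc 0 T) s := by
    intro s hs
    obtain ⟨ω, hω⟩ := hgap s hs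
    exact (hasDerivAt_clusterProj_count hH₀ hX hω hWi hW).hasDerivWithinAt
  obtain ⟨U, -, -, hU1, hU2, hUP⟩ := exists_unitary_flow hDc hDM hDh T hP
  have hTmem : T ∈ Set.Icc (0 : ℝ) T := ⟨hT, le_rfl⟩
  refine ⟨U T, ?_, ?_⟩
  · rw [Unitary.mem_iff, star_eq_conjTranspose]
    exact ⟨hU1 T hTmem, hU2 T hTmem⟩
  · rw [star_eq_conjTranspose]
    exact hUP T hTmem

/-- **The spectral flow with its defining data.** As `exists_spectral_flow_of_clusterGap`, but
returning the whole flow `t ↦ U(t)` on `[0, T]` together with the weight `W` of its generator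
`D(t) = ∫ W(τ) τ_τ^{H_t}(X) dτ` (measurable, with bounded and integrable moments, integrable,
`∫ e^{iτΔ} W = i/Δ` for `|Δ| ≥ g/2`, real-valued): `U(0) = 1`, `∂_t U = i D(t) U` within `[0, T]`,
`U(t)` unitary and `U(t)ᴴ P(t) U(t) = P(0)` for all `t ∈ [0, T]`. This is the form needed by the
Lieb–Robinson estimates for the flow (`FlowLiebRobinsonProofs`, `FlowQuasiLocalityProofs`), which
take `U` through exactly these hypotheses. [cite: MichalakisZwolakCMP2013, §5.2 (arXiv:1109.1588 pp. 10–12)] -/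
theorem exists_spectral_flow_data_of_clusterGap {H₀ X : Matrix n n ℂ} (hH₀ : H₀.IsHermitian)
    (hX : X.IsHermitian) {m : ℕ} {g T : ℝ} (hg : 0 < g)
    (hgap : ∀ t ∈ Set.Icc (0 : ℝ) T, ∃ ω : ℝ, (H₀ + t • X).HasClusterGap m ω g) :
    ∃ (W : ℝ → ℂ) (U : ℝ → Matrix n n ℂ), AEStronglyMeasurable W volume ∧
      (∀ k : ℕ, ∃ M : ℝ, ∀ t : ℝ, |t| ^ k * ‖W t‖ ≤ M) ∧
      (∀ k : ℕ, Integrable fun t : ℝ => ‖t‖ ^ k * ‖W t‖) ∧ Integrable W ∧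
      (∀ Δ : ℝ, g / 2 ≤ |Δ| → ∫ t : ℝ, cexp (t * Δ * I) * W t = I / Δ) ∧
      (∀ t : ℝ, starRingEnd ℂ (W t) = W t) ∧
      U 0 = 1 ∧
      (∀ t ∈ Set.Icc (0 : ℝ) T, HasDerivWithinAt U
        (((Complex.I : ℂ) • ∫ τ : ℝ, W τ • heisenbergEvolution (H₀ + t • X) τ X) * U t)
        (Set.Icc 0 T) t) ∧
      (∀ t ∈ Set.Icc (0 : ℝ) T, (U t)ᴴ * U t = 1) ∧ (∀ t ∈ Set.Icc (0 : ℝ) T, U t * (U t)ᴴ = 1) ∧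
      (∀ t ∈ Set.Icc (0 : ℝ) T, (U t)ᴴ * projMatrix (Submodule.span ℂ (Set.range fun i :
          (univ.filter fun k => (univ.filter fun l =>
            (isHermitian_affinePath hH₀ hX t).eigenvalues l ≤
              (isHermitian_affinePath hH₀ hX t).eigenvalues k).card ≤ m) =>
            (isHermitian_affinePath hH₀ hX t).eigenvectorBasis i)) * U t =
        projMatrix (Submodule.span ℂ (Set.range fun i :
          (univ.filter fun k => (univ.filter fun l =>
            (isHermitian_affinePath hH₀ hX 0).eigenvalues l ≤
              (isHermitian_affinePath hH₀ hX 0).eigenvalues k).card ≤ m) =>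
            (isHermitian_affinePath hH₀ hX 0).eigenvectorBasis i))) := by
  set hHt := isHermitian_affinePath hH₀ hX with hhHt
  obtain ⟨W, hWm, hWmom, hWmomi, hWi, hW, hWr⟩ := exists_spectralFlowWeight (half_pos hg)
  set D : ℝ → Matrix n n ℂ := fun t => ∫ τ : ℝ, W τ • heisenbergEvolution (H₀ + t • X) τ X with hDdef
  have hDc : Continuous D := continuous_integral_smul_heisenbergEvolution_affine hH₀ hX hWi X
  have hDM : ∀ t, ‖D t‖ ≤ (∫ τ : ℝ, ‖W τ‖) * ‖X‖ := fun t =>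
    norm_integral_smul_heisenbergEvolution_affine_le hH₀ hX W X t
  have hDh : ∀ t, (D t).IsHermitian := fun t =>
    isHermitian_integral_smul_heisenbergEvolution (hHt t) hX hWi hWr
  set P : ℝ → Matrix n n ℂ := fun t => projMatrix (Submodule.span ℂ (Set.range fun i :
      (univ.filter fun k => (univ.filter fun l =>
        (hHt t).eigenvalues l ≤ (hHt t).eigenvalues k).card ≤ m) => (hHt t).eigenvectorBasis i))
    with hPdef
  rcases isEmpty_or_nonempty n with hn | hn
  · refine ⟨W, fun _ => 1, hWm, hWmom, hWmomi, hWi, hW, hWr, rfl, fun t _ => ?_,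
      fun t _ => Subsingleton.elim _ _, fun t _ => Subsingleton.elim _ _, fun t _ => Subsingleton.elim _ _⟩
    have : ((Complex.I : ℂ) • ∫ τ : ℝ, W τ • heisenbergEvolution (H₀ + t • X) τ X) * 1 = 0 :=
      Subsingleton.elim _ _
    rw [this]
    exact hasDerivWithinAt_const _ _ _
  have hP : ∀ s ∈ Set.Icc (0 : ℝ) T,
      HasDerivWithinAt P ((Complex.I : ℂ) • (D s * P s - P s * D s)) (Set.Icc 0 T) s := by
    intro s hs
    obtain ⟨ω, hω⟩ := hgap s hs
    exact (hasDerivAt_clusterProj_count hH₀ hX hω hWi hW).hasDerivWithinAt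
  obtain ⟨U, hU0, hUd, hU1, hU2, hUP⟩ := exists_unitary_flow hDc hDM hDh T hP
  exact ⟨W, U, hWm, hWmom, hWmomi, hWi, hW, hWr, hU0, hUd, hU1, hU2, hUP⟩

end Flow

end Literature.MathematicalPhysics.QuantumLattice
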